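import Literature.NumberTheory.EllipticCurves.TunnellWaldspurgerCorollaryProofs
import Literature.NumberTheory.EllipticCurves.TunnellThmTwoTrivProofs
import HarnessLib

/-!
# Waldspurger's proportionality for `g θ₂` (and `g θ₄`) from a symmetric family of weight-`3/2` lifts

Endgame of an explicit (theta-lift) proof of the named facts
`Literature.NumberTheory.EllipticCurves.Tunnell1983_a_sq_propto_L_one` — Tunnell 1983, p. 329,
ll. 10–12: `a(n)² = β₁² L(Eⁿ, 1) √n` (`n ≡ 1 (8)`), `a(n)² = β₃² L(Eⁿ, 1) √n` (`n ≡ 3 (8)`) for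
square-free `n`, which Tunnell takes from Waldspurger 1981, Thm 1 / Cor. 2 applied to the Shimura
lift `φ` of `g θ₂, g θ₈` (Theorem 2) — and of its even twin
`Literature.NumberTheory.EllipticCurves.Tunnell1983_b_sq_propto_L_one` (p. 329, ll. 22–27, `g θ₄`,
character `χ₂`, classes `1, 5`, `L(E²ⁿ, 1)`). This file isolates, and PROVES, the purely algebraic
last step of the explicit route through Shintani's theta lift (Shintani 1975; Kohnen 1985, §1,
proof of Thm 3 and Cor. 1; the analytic files `ShintaniSchwartzFourier`, `ShintaniThetaInversion`,
`ShintaniGenusSymbols` of the tree build the lift), in a form that needs NO Petersson product, NO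
adjoint (Shimura–Niwa) direction and NO multiplicity-one statement beyond the tree's Theorem 2
(described for the odd case; the even case is literally parallel, see the last section):

Suppose that for the square-free `D` of one odd class `r ∈ {1, 3}` modulo `8` we are given numbers
`R(D, m)` (in the application: the `m`-th Fourier coefficient of the `D`-th twisted lift `G_D`
of `φ`, a cycle-integral sum over binary quadratic forms of discriminant `∝ D m` weighted by the
genus character `χ_D`) such that

* (H1) `R(D, ·) = A_D · a(·)` on the class `r` for some scalar `A_D` — automatic when
  `G_D ∈ S_{3/2}(128, 1)` for `r = 3`, and when `G_D ∈ span {g θ₂, g θ₈}` (equivalently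
  `G_D ∈ S_{3/2}(128, 1)` and `T(3²) G_D = 0`) for `r = 1` (`exists_qCoeffs_eq_mul_a_three_of_mem`,
  `exists_qCoeffs_eq_mul_a_one_of_mem_span_pair`, `mem_span_pair_of_heckeTSq_three_eq_zero`: the
  tree's basis `{g θ₂, g θ₈, g θ₃₂}` of `S_{3/2}(128, 1)`, the supports of `d₈, d₃₂` and
  `d₈ = d₂` on the class `1`, and the matrix of `T(3²)`);
* (H2) the single symmetry `R(D, D₀) = R(D₀, D)` with `D₀ = 1` (`r = 1`) resp. `D₀ = 3` (`r = 3`)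
  — in the application the genus-character identity `χ_D(Q) = χ_{D₀}(Q)` on forms of discriminant
  `D D₀` (Gross–Kohnen–Zagier 1987, §I.2, Prop. 1; Kohnen 1985, (5)), the two coefficients being
  the SAME weighted sum of cycle integrals;
* (H3) the diagonal `R(D, D) = κ · L(E_D, 1) √D` with one constant `κ ≠ 0` — in the application the
  split forms of square discriminant, whose cycles run cusp to cusp, so that the cycle integrals are
  additively twisted periods of `φ` summing to `G(χ_D) L(φ ⊗ χ_D, 1)` (Kohnen 1985, proof of Cor. 1;
  Kohnen–Zagier 1981, §1), `G(χ_D) = √D` by Gauss's sign theorem;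

then `A_D a(D₀) = R(D, D₀) = R(D₀, D) = A_{D₀} a(D)`, so `A_D = A_{D₀} a(D) / a(D₀)`
(`a(1) = 1`, `a(3) = 2`), and `κ L(E_D, 1) √D = R(D, D) = A_D a(D) = (A_{D₀}/a(D₀)) a(D)²`; at
`D = D₀` this reads `A_{D₀}/a(D₀) = κ L(E_{D₀}, 1) √D₀ / a(D₀)² ≠ 0` (`L(E₁, 1) = β/4`,
`L(E₃, 1) = β/√3`, non-zero in the tree), whence

  **`a(D)² = (a(D₀)² / (L(E_{D₀}, 1) √D₀)) · L(E_D, 1) √D`** on the class of `D₀`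

(`sq_eq_of_symmetricFamily`, stated for an abstract coefficient function and abstract central
values), i.e. exactly the displays of p. 329 with `β₁² = 1 / L(E₁, 1)`, `β₃² = 4 / (L(E₃, 1) √3)` —
and `Tunnell1983_a_sq_propto_L_one` from two such families
(`Tunnell1983_a_sq_propto_L_one_of_symmetricFamilies`), resp. directly from two families of cusp
forms `G_D ∈ S_{3/2}(128, 1)` with `T(3²) G_D = 0` on the class `1`
(`Tunnell1983_a_sq_propto_L_one_of_lifts`). The remaining analytic input for the odd case of
Tunnell's theorem is thereby reduced to producing, for `D` square-free in the classes `1, 3 (8)`,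
cusp forms `G_D ∈ S_{3/2}(128, 1)` (killed by `T(3²)` on the class `1`) whose coefficients satisfy
the one symmetry (H2) and the diagonal evaluation (H3) — Shintani's lift of `φ` twisted by `χ_D`.
EVEN CASE (`Tunnell1983_b_sq_propto_L_one_of_symmetricFamilies`, `…_of_lifts`): families
`G_D ∈ S_{3/2}(128, χ₂)` on the classes `1, 5 (8)` with `a_{G_D}(2) = 0` (this alone splits off
`g θ₁`, the only vector of the tree's basis `{g θ₁, g θ₄, g θ₁₆}` with an even exponent — no Hecke
operator needed; `exists_qCoeffs_eq_mul_b_of_mem_chi2`), the symmetry with `D₀ = 1` resp. `5`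
(`L(E₂, 1)`, `L(E₁₀, 1) ≠ 0` in the tree) and the diagonal `a_{G_D}(D) = κ L(E_{2D}, 1) √D`.

Why the auxiliary index may be FIXED (`1`, `3`) rather than coprime to `D`: the symmetry
`χ_D(Q) = χ_{D'}(Q)` holds on all forms of discriminant `D D' f²` with the Gross–Kohnen–Zagier
convention `χ_D(Q) = 0` when `gcd(Q, D) > 1`, coprimality is not needed; so no non-vanishing of
`a(q)` for auxiliary primes `q` (and no Dirichlet theorem) enters.

No definitions and no named facts are introduced (D-0026); the hypotheses (H1)–(H3) are spelled out.

## References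

* J. B. Tunnell, *A classical Diophantine problem and modular forms of weight 3/2*, Invent. Math.
  72 (1983) 323–334: Theorem (Waldspurger) p. 328, proof of Thm 3 p. 329 ll. 7–19.
  [Tunnell1983Congruent]
* J.-L. Waldspurger, *Sur les coefficients de Fourier des formes modulaires de poids demi-entier*,
  J. Math. Pures Appl. 60 (1981) 375–484, Thm 1, Cor. 2. [Waldspurger1981Fourier]
* W. Kohnen, *Fourier coefficients of modular forms of half-integral weight*, Math. Ann. 271 (1985)
  237–268, §1, Thm 3, Cor. 1 and (5) (the cycle-integral sums `r_{k,N}(f; D, D')`, symmetric in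
  `D, D'`, and the diagonal `D = D'`).
* W. Kohnen, D. Zagier, *Values of L-series of modular forms at the centre of the critical strip*,
  Invent. Math. 64 (1981) 175–198, §1.
* B. Gross, W. Kohnen, D. Zagier, *Heegner points and derivatives of L-series. II*, Math. Ann. 278
  (1987) 497–562, §I.2 (the genus character `χ_D(Q)`).
* T. Shintani, *On construction of holomorphic cusp forms of half integral weight*, Nagoya Math. J.
  58 (1975) 83–126, Thm 2.
-/

noncomputable section

open UpperHalfPlane hiding I
open Complex
open scoped NumberTheorySymbols

namespace Literature.NumberTheory.EllipticCurves.Tunnell1983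

open Literature.NumberTheory.EllipticCurves.ModularForms

/-! ### The algebra of a symmetric family on one class modulo `8` -/

/-- **The symmetric-family lemma** (the algebra of Kohnen 1985, proof of Cor. 1, with the adjoint
lift replaced by the symmetry of `r(f; D, D')` in `D, D'`), stated for an abstract coefficient
function `c` (`a` or `b`), abstract central values `Lv` (`L(E_D, 1)` or `L(E_{2D}, 1)`) under a
guard, and numbers `R(D, m)`: on one class `r (mod 8)` containing the square-free auxiliary index
`D₀` with `Lv(D₀) ≠ 0`, the hypotheses (H1) `R(D, m) = A_D c(m)` on the class, (H2)
`R(D, D₀) = R(D₀, D)`, (H3) `R(D, D) = κ Lv(D) √D` with `κ ≠ 0` give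
`c(D)² = (c(D₀)² / (Lv(D₀) √D₀)) Lv(D) √D` for every square-free `D ≡ r (8)`:
`κ Lv(D₀) √D₀ · c(D)² = A_{D₀} c(D₀) c(D)² = A_D c(D₀)² c(D) = c(D₀)² · κ Lv(D) √D`, cancel `κ`
(no non-vanishing of `c(D₀)` is used). [cite: Tunnell1983Congruent, proof of Thm 3, p. 329, ll. 7–27]
[cite: Waldspurger1981Fourier, Cor. 2] -/
theorem sq_eq_of_symmetricFamily {r D₀ : ℕ} (R : ℕ → ℕ → ℂ) (c Lv : ℕ → ℂ) (guard : ℕ → Prop)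
    {κ : ℂ} (hκ : κ ≠ 0) (hD₀ : Squarefree D₀) (hD₀r : D₀ % 8 = r) (hg₀ : guard D₀)
    (hL₀ : Lv D₀ ≠ 0)
    (hA : ∀ ⦃D : ℕ⦄, Squarefree D → D % 8 = r → ∃ A : ℂ, ∀ ⦃m : ℕ⦄, m % 8 = r → R D m = A * c m)
    (hsymm : ∀ ⦃D : ℕ⦄, Squarefree D → D % 8 = r → R D D₀ = R D₀ D)
    (hdiag : ∀ ⦃D : ℕ⦄, Squarefree D → D % 8 = r → guard D →
      R D D = κ * Lv D * (Real.sqrt D : ℂ))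
    ⦃D : ℕ⦄ (hD : Squarefree D) (hDr : D % 8 = r) (hgD : guard D) :
    c D ^ 2 = c D₀ ^ 2 * (Lv D₀ * (Real.sqrt D₀ : ℂ))⁻¹ * Lv D * (Real.sqrt D : ℂ) := by
  obtain ⟨A₀, hA₀⟩ := hA hD₀ hD₀r
  obtain ⟨A, hAD⟩ := hA hD hDr
  -- the three relations
  have e1 : A * c D₀ = A₀ * c D := by
    rw [← hA₀ hDr, ← hAD hD₀r]
    exact hsymm hD hDr
  have e2 : A * c D = κ * Lv D * (Real.sqrt D : ℂ) := by
    rw [← hAD hDr]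
    exact hdiag hD hDr hgD
  have e3 : A₀ * c D₀ = κ * Lv D₀ * (Real.sqrt D₀ : ℂ) := by
    rw [← hA₀ hD₀r]
    exact hdiag hD₀ hD₀r hg₀
  have hs₀ : (Real.sqrt D₀ : ℂ) ≠ 0 := by
    have h0 : (0 : ℝ) < D₀ := by exact_mod_cast Nat.pos_of_ne_zero hD₀.ne_zero
    exact Complex.ofReal_ne_zero.2 (Real.sqrt_pos.2 h0).ne'
  set L₀ := Lv D₀
  set LD := Lv D
  set s₀ := (Real.sqrt D₀ : ℂ)
  set sD := (Real.sqrt D : ℂ)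
  -- `κ L₀ s₀ c(D)² = A₀ c(D₀) c(D)² = A c(D₀)² c(D) = c(D₀)² κ L_D s_D`
  have key : κ * (c D ^ 2 * (L₀ * s₀)) = κ * (c D₀ ^ 2 * LD * sD) := by
    linear_combination (-(c D ^ 2)) * e3 - (c D₀ * c D) * e1 + (c D₀ ^ 2) * e2
  have key' := mul_left_cancel₀ hκ key
  rw [show c D₀ ^ 2 * (L₀ * s₀)⁻¹ * LD * sD = (c D₀ ^ 2 * LD * sD) * (L₀ * s₀)⁻¹ by ring, ← key',
    mul_assoc, mul_inv_cancel₀ (mul_ne_zero hL₀ hs₀), mul_one]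

/-- The same, packaged as a proportionality with an unnamed constant (the shape of the conjuncts of
`Tunnell1983_a_sq_propto_L_one` / `Tunnell1983_b_sq_propto_L_one`).
[cite: Tunnell1983Congruent, proof of Thm 3, p. 329] -/
theorem exists_sq_propto_of_symmetricFamily {r D₀ : ℕ} (R : ℕ → ℕ → ℂ) (c Lv : ℕ → ℂ)
    (guard : ℕ → Prop) {κ : ℂ} (hκ : κ ≠ 0) (hD₀ : Squarefree D₀) (hD₀r : D₀ % 8 = r)
    (hg₀ : guard D₀) (hL₀ : Lv D₀ ≠ 0)
    (hA : ∀ ⦃D : ℕ⦄, Squarefree D → D % 8 = r → ∃ A : ℂ, ∀ ⦃m : ℕ⦄, m % 8 = r → R D m = A * c m)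
    (hsymm : ∀ ⦃D : ℕ⦄, Squarefree D → D % 8 = r → R D D₀ = R D₀ D)
    (hdiag : ∀ ⦃D : ℕ⦄, Squarefree D → D % 8 = r → guard D →
      R D D = κ * Lv D * (Real.sqrt D : ℂ)) :
    ∃ C : ℂ, ∀ ⦃D : ℕ⦄, Squarefree D → D % 8 = r → guard D →
      c D ^ 2 = C * Lv D * (Real.sqrt D : ℂ) :=
  ⟨_, fun _ hD hDr hg ↦ sq_eq_of_symmetricFamily R c Lv guard hκ hD₀ hD₀r hg₀ hL₀ hA hsymm hdiag
    hD hDr hg⟩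

/-! ### The odd case: `g θ₂`, classes `1, 3 (mod 8)`, auxiliary indices `1, 3` -/

/-- **`Tunnell1983_a_sq_propto_L_one` from two symmetric families** (classes `1` and `3`, auxiliary
indices `D₀ = 1`: `L(E₁, 1) = β/4 ≠ 0`, and `D₀ = 3`: `L(E₃, 1) = β/√3 ≠ 0`).
[cite: Tunnell1983Congruent, proof of Thm 3, p. 329, ll. 7–19] [cite: Waldspurger1981Fourier, Cor. 2] -/
theorem Tunnell1983_a_sq_propto_L_one_of_symmetricFamilies (R₁ R₃ : ℕ → ℕ → ℂ) {κ₁ κ₃ : ℂ}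
    (hκ₁ : κ₁ ≠ 0) (hκ₃ : κ₃ ≠ 0)
    (hA₁ : ∀ ⦃D : ℕ⦄, Squarefree D → D % 8 = 1 →
      ∃ A : ℂ, ∀ ⦃m : ℕ⦄, m % 8 = 1 → R₁ D m = A * (a m : ℂ))
    (hsymm₁ : ∀ ⦃D : ℕ⦄, Squarefree D → D % 8 = 1 → R₁ D 1 = R₁ 1 D)
    (hdiag₁ : ∀ ⦃D : ℕ⦄, Squarefree D → D % 8 = 1 → (congruentNumberCurve D).HasEntireLFunction →
      R₁ D D = κ₁ * (congruentNumberCurve D).entireLFunction 1 * (Real.sqrt D : ℂ))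
    (hA₃ : ∀ ⦃D : ℕ⦄, Squarefree D → D % 8 = 3 →
      ∃ A : ℂ, ∀ ⦃m : ℕ⦄, m % 8 = 3 → R₃ D m = A * (a m : ℂ))
    (hsymm₃ : ∀ ⦃D : ℕ⦄, Squarefree D → D % 8 = 3 → R₃ D 3 = R₃ 3 D)
    (hdiag₃ : ∀ ⦃D : ℕ⦄, Squarefree D → D % 8 = 3 → (congruentNumberCurve D).HasEntireLFunction →
      R₃ D D = κ₃ * (congruentNumberCurve D).entireLFunction 1 * (Real.sqrt D : ℂ)) :
    Tunnell1983_a_sq_propto_L_one := by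
  have hL := @hasEntireLFunction_congruentNumberCurve_holds
  obtain ⟨c₁, hc₁⟩ := exists_sq_propto_of_symmetricFamily R₁ (fun m ↦ (a m : ℂ))
    (fun D ↦ (congruentNumberCurve D).entireLFunction 1)
    (fun D ↦ (congruentNumberCurve D).HasEntireLFunction) hκ₁ squarefree_one rfl
    (hL squarefree_one) entireLFunction_congruentNumberCurve_one_one_ne_zero hA₁ hsymm₁ hdiag₁
  obtain ⟨c₃, hc₃⟩ := exists_sq_propto_of_symmetricFamily R₃ (fun m ↦ (a m : ℂ))
    (fun D ↦ (congruentNumberCurve D).entireLFunction 1)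
    (fun D ↦ (congruentNumberCurve D).HasEntireLFunction) hκ₃ Nat.prime_three.prime.squarefree rfl
    (hL Nat.prime_three.prime.squarefree) entireLFunction_congruentNumberCurve_three_one_ne_zero
    hA₃ hsymm₃ hdiag₃
  exact ⟨c₁, c₃, fun D hD hLD ↦ ⟨fun h1 ↦ hc₁ hD h1 hLD, fun h3 ↦ hc₃ hD h3 hLD⟩⟩

/-! ### (H1) from membership: coefficients of forms in `S_{3/2}(128, 1)` on the odd classes -/

/-- **On the class `3 (mod 8)` every `G ∈ S_{3/2}(128, 1)` has coefficients `A · a(m)`**: by the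
tree's basis theorem `G = x g θ₂ + y g θ₈ + z g θ₃₂` (`halfIntCuspForms_three_le_span_triv`),
`g θ₈, g θ₃₂` live on the class `1` and `d₂(m) = a(m)` for odd `m`; `A = x`.
[cite: Tunnell1983Congruent, Thm 1 and p. 327] -/
theorem exists_qCoeffs_eq_mul_a_three_of_mem {G : ℍ → ℂ} (hG : G ∈ halfIntCuspForms 3 128 1) :
    ∃ A : ℂ, ∀ ⦃m : ℕ⦄, m % 8 = 3 → qCoeffs G m = A * (a m : ℂ) := by
  obtain ⟨x, y, z, hxyz⟩ := Submodule.mem_span_triple.mp (halfIntCuspForms_three_le_span_triv hG)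
  refine ⟨x, fun m hm ↦ ?_⟩
  have hodd : Odd m := Nat.odd_iff.mpr (by omega)
  rw [← hxyz, qCoeffs_lincomb_triv]
  dsimp only
  rw [formCoeff_eight_eq_zero (by omega), formCoeff_thirtyTwo_eq_zero (by omega),
    ← formCoeff_two_eq_a hodd]
  push_cast
  ring

/-- **On both odd classes every `G ∈ span {g θ₂, g θ₈}` has coefficients `A · a(m)`**:
`G = x g θ₂ + y g θ₈`; on the class `1`, `d₈ = d₂` (`formCoeff_eight_eq`), so `A = x + y`; on the
class `3`, `d₈ = 0`, so `A = x`. [cite: Tunnell1983Congruent, Thm 2 and p. 327] -/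
theorem exists_qCoeffs_eq_mul_a_one_of_mem_span_pair {G : ℍ → ℂ}
    (hG : G ∈ Submodule.span ℂ ({tunnellForm 2, tunnellForm 8} : Set (ℍ → ℂ))) :
    (∃ A : ℂ, ∀ ⦃m : ℕ⦄, m % 8 = 1 → qCoeffs G m = A * (a m : ℂ)) ∧
    (∃ A : ℂ, ∀ ⦃m : ℕ⦄, m % 8 = 3 → qCoeffs G m = A * (a m : ℂ)) := by
  obtain ⟨x, y, hxy⟩ := Submodule.mem_span_pair.mp hG
  have hG' : x • tunnellForm 2 + y • tunnellForm 8 + (0 : ℂ) • tunnellForm 32 = G := by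
    rw [zero_smul, add_zero]
    exact hxy
  refine ⟨⟨x + y, fun m hm ↦ ?_⟩, ⟨x, fun m hm ↦ ?_⟩⟩
  · have hodd : Odd m := Nat.odd_iff.mpr (by omega)
    rw [← hG', qCoeffs_lincomb_triv]
    dsimp only
    rw [formCoeff_eight_eq hm, ← formCoeff_two_eq_a hodd]
    push_cast
    ring
  · have hodd : Odd m := Nat.odd_iff.mpr (by omega)
    rw [← hG', qCoeffs_lincomb_triv]
    dsimp only
    rw [formCoeff_eight_eq_zero (by omega), ← formCoeff_two_eq_a hodd]
    push_cast
    ring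

/-- **`S_{3/2}(128, 1) ∩ ker T(3²) = span {g θ₂, g θ₈}`** (the containment `⊆`): writing
`G = x g θ₂ + y g θ₈ + z g θ₃₂`, `T(3²)` kills `g θ₂, g θ₈` up to multiples of themselves
(eigenforms) and maps `g θ₃₂ ↦ 2 g θ₈ - 4 g θ₃₂` (`heckeTSq_three_thirtytwo`); the coefficients of
`T(3²) G = 0` at `q¹` and `q⁹` are `x λ₃ - 2z` and `x λ₃ + 6z`, so `z = 0`. (By Theorem 2,
`λ₃ = a₃(E) = 0`, which is not needed.) [cite: Tunnell1983Congruent, proof of Thm 2, pp. 327–328] -/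
theorem mem_span_pair_of_heckeTSq_three_eq_zero {G : ℍ → ℂ} (hG : G ∈ halfIntCuspForms 3 128 1)
    (h9 : heckeTSq 3 (1 : DirichletCharacter ℂ 128) 3 (qCoeffs G) = 0) :
    G ∈ Submodule.span ℂ ({tunnellForm 2, tunnellForm 8} : Set (ℍ → ℂ)) := by
  have hCO := halfIntCuspForms_three_le_span_triv
  obtain ⟨x, y, z, hxyz⟩ := Submodule.mem_span_triple.mp (hCO hG)
  -- `qCoeffs G` as a combination of the three coefficient functions
  have hq : qCoeffs G = x • qCoeffs (tunnellForm 2) + y • qCoeffs (tunnellForm 8) +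
      z • qCoeffs (tunnellForm 32) := by
    rw [← hxyz, qCoeffs_lincomb_triv, qCoeffs_tunnellForm two_pos,
      qCoeffs_tunnellForm (by norm_num : 0 < 8), qCoeffs_tunnellForm (by norm_num : 0 < 32)]
    funext N
    simp only [Pi.add_apply, Pi.smul_apply, smul_eq_mul]
  rw [hq, map_add, map_add, map_smul, map_smul, map_smul,
    heckeTSq_tunnellForm_two Nat.prime_three (by norm_num), heckeTSq_three_eight hCO,
    heckeTSq_three_thirtytwo hCO, qCoeffs_tunnellForm two_pos] at h9
  have h1 := congr_fun h9 1
  have h9' := congr_fun h9 9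
  simp only [Pi.add_apply, Pi.smul_apply, smul_eq_mul, Pi.zero_apply, mul_zero, add_zero] at h1 h9'
  rw [formCoeff_two_one, formCoeff_eight_one, formCoeff_thirtytwo_one] at h1
  rw [formCoeff_two_nine, formCoeff_eight_nine, formCoeff_thirtytwo_nine] at h9'
  have hz : z = 0 := by linear_combination (h9' - h1) / 8
  rw [← hxyz, hz, zero_smul, add_zero]
  exact Submodule.add_mem _ (Submodule.smul_mem _ _ (Submodule.subset_span (by simp)))
    (Submodule.smul_mem _ _ (Submodule.subset_span (by simp)))

/-! ### The reduction: two families of cusp forms -/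

/-- **`Tunnell1983_a_sq_propto_L_one` from two symmetric families of cusp forms in
`S_{3/2}(128, 1)`** — the target of the explicit Shintani-lift route for the odd case of Tunnell's
theorem: for `D` square-free in the class `1` (resp. `3`) a cusp form `G_D` of weight `3/2`, level
`128`, trivial character, killed by `T(3²)` on the class `1` (the lift of `φ`, `a₃(φ) = 0`), with
(H2) `a_{G_D}(1) = a_{G_1}(D)` (resp. `a_{G_D}(3) = a_{G_3}(D)`) and (H3)
`a_{G_D}(D) = κ L(E_D, 1) √D`, `κ ≠ 0`. [cite: Tunnell1983Congruent, pp. 328–329]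
[cite: Waldspurger1981Fourier, Cor. 2] -/
theorem Tunnell1983_a_sq_propto_L_one_of_lifts (G₁ G₃ : ℕ → ℍ → ℂ) {κ₁ κ₃ : ℂ}
    (hκ₁ : κ₁ ≠ 0) (hκ₃ : κ₃ ≠ 0)
    (hmem₁ : ∀ ⦃D : ℕ⦄, Squarefree D → D % 8 = 1 → G₁ D ∈ halfIntCuspForms 3 128 1)
    (hT₁ : ∀ ⦃D : ℕ⦄, Squarefree D → D % 8 = 1 →
      heckeTSq 3 (1 : DirichletCharacter ℂ 128) 3 (qCoeffs (G₁ D)) = 0)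
    (hsymm₁ : ∀ ⦃D : ℕ⦄, Squarefree D → D % 8 = 1 → qCoeffs (G₁ D) 1 = qCoeffs (G₁ 1) D)
    (hdiag₁ : ∀ ⦃D : ℕ⦄, Squarefree D → D % 8 = 1 → (congruentNumberCurve D).HasEntireLFunction →
      qCoeffs (G₁ D) D = κ₁ * (congruentNumberCurve D).entireLFunction 1 * (Real.sqrt D : ℂ))
    (hmem₃ : ∀ ⦃D : ℕ⦄, Squarefree D → D % 8 = 3 → G₃ D ∈ halfIntCuspForms 3 128 1)
    (hsymm₃ : ∀ ⦃D : ℕ⦄, Squarefree D → D % 8 = 3 → qCoeffs (G₃ D) 3 = qCoeffs (G₃ 3) D)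
    (hdiag₃ : ∀ ⦃D : ℕ⦄, Squarefree D → D % 8 = 3 → (congruentNumberCurve D).HasEntireLFunction →
      qCoeffs (G₃ D) D = κ₃ * (congruentNumberCurve D).entireLFunction 1 * (Real.sqrt D : ℂ)) :
    Tunnell1983_a_sq_propto_L_one :=
  Tunnell1983_a_sq_propto_L_one_of_symmetricFamilies (fun D m ↦ qCoeffs (G₁ D) m)
    (fun D m ↦ qCoeffs (G₃ D) m) hκ₁ hκ₃
    (fun _ hD h1 ↦ (exists_qCoeffs_eq_mul_a_one_of_mem_span_pair
      (mem_span_pair_of_heckeTSq_three_eq_zero (hmem₁ hD h1) (hT₁ hD h1))).1)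
    hsymm₁ hdiag₁
    (fun _ hD h3 ↦ exists_qCoeffs_eq_mul_a_three_of_mem (hmem₃ hD h3)) hsymm₃ hdiag₃

/-! ### The even case: `g θ₄`, character `χ₂`, classes `1, 5 (mod 8)`, auxiliary indices `1, 5` -/

/-- **On both classes `1, 5 (mod 8)` every `G ∈ S_{3/2}(128, χ₂)` with `a_G(2) = 0` has
coefficients `A · b(m)`**: by the tree's basis theorem `G = x g θ₁ + y g θ₄ + z g θ₁₆`
(`halfIntCuspForms_three_le_span_chi2`); the coefficient of `q²` is `2x` (`d₁(2) = 2`,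
`d₄(2) = d₁₆(2) = 0`), so `x = 0`; on the class `1`, `d₁₆ = d₄` (`formCoeff_four_sub_sixteen_eq_zero`),
so `A = y + z`; on the class `5`, `d₁₆ = 0`, so `A = y`; and `d₄(m) = b(m)` for odd `m`. (No Hecke
operator is needed to split off `g θ₁`: it is the only basis vector with an even exponent.)
[cite: Tunnell1983Congruent, Thm 2 and p. 327] -/
theorem exists_qCoeffs_eq_mul_b_of_mem_chi2 {G : ℍ → ℂ}
    (hG : G ∈ halfIntCuspForms 3 128 tunnellChar) (h2 : qCoeffs G 2 = 0) :
    (∃ A : ℂ, ∀ ⦃m : ℕ⦄, m % 8 = 1 → qCoeffs G m = A * (b m : ℂ)) ∧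
    (∃ A : ℂ, ∀ ⦃m : ℕ⦄, m % 8 = 5 → qCoeffs G m = A * (b m : ℂ)) := by
  obtain ⟨x, y, z, hxyz⟩ := Submodule.mem_span_triple.mp (halfIntCuspForms_three_le_span_chi2 hG)
  have hx : x = 0 := by
    rw [← hxyz, qCoeffs_lincomb] at h2
    dsimp only at h2
    rw [formCoeff_one_two, formCoeff_four_two, formCoeff_sixteen_two] at h2
    linear_combination h2 / 2
  subst hx
  refine ⟨⟨y + z, fun m hm ↦ ?_⟩, ⟨y, fun m hm ↦ ?_⟩⟩
  · have hodd : Odd m := Nat.odd_iff.mpr (by omega)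
    have h416 : (formCoeff 16 m : ℂ) = formCoeff 4 m := by
      have := formCoeff_four_sub_sixteen_eq_zero (N := m) (by omega)
      linear_combination -this
    rw [← hxyz, qCoeffs_lincomb]
    dsimp only
    rw [h416, ← formCoeff_four_eq_b hodd]
    push_cast
    ring
  · have hodd : Odd m := Nat.odd_iff.mpr (by omega)
    rw [← hxyz, qCoeffs_lincomb]
    dsimp only
    rw [formCoeff_sixteen_eq_zero (by omega), ← formCoeff_four_eq_b hodd]
    push_cast
    ring

/-- **`Tunnell1983_b_sq_propto_L_one` from two symmetric families** (classes `1` and `5`, auxiliary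
indices `D₀ = 1`: `L(E₂, 1) = β/(2√2) ≠ 0`, and `D₀ = 5`: `L(E₁₀, 1) = 2β/√10 ≠ 0`; Tunnell p. 329,
ll. 22–27: the pairs `(n, 1)`, `(n, 5)`). [cite: Tunnell1983Congruent, proof of Thm 3, p. 329, ll. 22–27]
[cite: Waldspurger1981Fourier, Cor. 2] -/
theorem Tunnell1983_b_sq_propto_L_one_of_symmetricFamilies (R₁ R₅ : ℕ → ℕ → ℂ) {κ₁ κ₅ : ℂ}
    (hκ₁ : κ₁ ≠ 0) (hκ₅ : κ₅ ≠ 0)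
    (hA₁ : ∀ ⦃D : ℕ⦄, Squarefree D → D % 8 = 1 →
      ∃ A : ℂ, ∀ ⦃m : ℕ⦄, m % 8 = 1 → R₁ D m = A * (b m : ℂ))
    (hsymm₁ : ∀ ⦃D : ℕ⦄, Squarefree D → D % 8 = 1 → R₁ D 1 = R₁ 1 D)
    (hdiag₁ : ∀ ⦃D : ℕ⦄, Squarefree D → D % 8 = 1 →
      (congruentNumberCurve (2 * D)).HasEntireLFunction →
      R₁ D D = κ₁ * (congruentNumberCurve (2 * D)).entireLFunction 1 * (Real.sqrt D : ℂ))
    (hA₅ : ∀ ⦃D : ℕ⦄, Squarefree D → D % 8 = 5 →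
      ∃ A : ℂ, ∀ ⦃m : ℕ⦄, m % 8 = 5 → R₅ D m = A * (b m : ℂ))
    (hsymm₅ : ∀ ⦃D : ℕ⦄, Squarefree D → D % 8 = 5 → R₅ D 5 = R₅ 5 D)
    (hdiag₅ : ∀ ⦃D : ℕ⦄, Squarefree D → D % 8 = 5 →
      (congruentNumberCurve (2 * D)).HasEntireLFunction →
      R₅ D D = κ₅ * (congruentNumberCurve (2 * D)).entireLFunction 1 * (Real.sqrt D : ℂ)) :
    Tunnell1983_b_sq_propto_L_one := by
  have hL := @hasEntireLFunction_congruentNumberCurve_holds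
  have h5 : Squarefree 5 := (Nat.prime_five).prime.squarefree
  obtain ⟨c₁, hc₁⟩ := exists_sq_propto_of_symmetricFamily R₁ (fun m ↦ (b m : ℂ))
    (fun D ↦ (congruentNumberCurve (2 * D)).entireLFunction 1)
    (fun D ↦ (congruentNumberCurve (2 * D)).HasEntireLFunction) hκ₁ squarefree_one rfl
    (hL (squarefree_two_mul_of_odd squarefree_one odd_one))
    entireLFunction_congruentNumberCurve_two_one_ne_zero hA₁ hsymm₁ hdiag₁
  obtain ⟨c₅, hc₅⟩ := exists_sq_propto_of_symmetricFamily R₅ (fun m ↦ (b m : ℂ))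
    (fun D ↦ (congruentNumberCurve (2 * D)).entireLFunction 1)
    (fun D ↦ (congruentNumberCurve (2 * D)).HasEntireLFunction) hκ₅ h5 rfl
    (hL (squarefree_two_mul_of_odd h5 (by decide)))
    entireLFunction_congruentNumberCurve_ten_one_ne_zero hA₅ hsymm₅ hdiag₅
  exact ⟨c₁, c₅, fun D hD hLD ↦ ⟨fun h1 ↦ hc₁ hD h1 hLD, fun h5' ↦ hc₅ hD h5' hLD⟩⟩

/-- **`Tunnell1983_b_sq_propto_L_one` from two symmetric families of cusp forms in
`S_{3/2}(128, χ₂)`** — the target of the explicit Shintani-lift route for the even case: for `D`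
square-free in the class `1` (resp. `5`) a cusp form `G_D` of weight `3/2`, level `128`, character
`χ₂` with `a_{G_D}(2) = 0`, (H2) `a_{G_D}(1) = a_{G_1}(D)` (resp. `a_{G_D}(5) = a_{G_5}(D)`) and (H3)
`a_{G_D}(D) = κ L(E_{2D}, 1) √D`, `κ ≠ 0`. [cite: Tunnell1983Congruent, pp. 328–329]
[cite: Waldspurger1981Fourier, Cor. 2] -/
theorem Tunnell1983_b_sq_propto_L_one_of_lifts (G₁ G₅ : ℕ → ℍ → ℂ) {κ₁ κ₅ : ℂ}
    (hκ₁ : κ₁ ≠ 0) (hκ₅ : κ₅ ≠ 0)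
    (hmem₁ : ∀ ⦃D : ℕ⦄, Squarefree D → D % 8 = 1 → G₁ D ∈ halfIntCuspForms 3 128 tunnellChar)
    (htwo₁ : ∀ ⦃D : ℕ⦄, Squarefree D → D % 8 = 1 → qCoeffs (G₁ D) 2 = 0)
    (hsymm₁ : ∀ ⦃D : ℕ⦄, Squarefree D → D % 8 = 1 → qCoeffs (G₁ D) 1 = qCoeffs (G₁ 1) D)
    (hdiag₁ : ∀ ⦃D : ℕ⦄, Squarefree D → D % 8 = 1 →
      (congruentNumberCurve (2 * D)).HasEntireLFunction →
      qCoeffs (G₁ D) D = κ₁ * (congruentNumberCurve (2 * D)).entireLFunction 1 * (Real.sqrt D : ℂ))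
    (hmem₅ : ∀ ⦃D : ℕ⦄, Squarefree D → D % 8 = 5 → G₅ D ∈ halfIntCuspForms 3 128 tunnellChar)
    (htwo₅ : ∀ ⦃D : ℕ⦄, Squarefree D → D % 8 = 5 → qCoeffs (G₅ D) 2 = 0)
    (hsymm₅ : ∀ ⦃D : ℕ⦄, Squarefree D → D % 8 = 5 → qCoeffs (G₅ D) 5 = qCoeffs (G₅ 5) D)
    (hdiag₅ : ∀ ⦃D : ℕ⦄, Squarefree D → D % 8 = 5 →
      (congruentNumberCurve (2 * D)).HasEntireLFunction →
      qCoeffs (G₅ D) D = κ₅ * (congruentNumberCurve (2 * D)).entireLFunction 1 * (Real.sqrt D : ℂ)) :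
    Tunnell1983_b_sq_propto_L_one :=
  Tunnell1983_b_sq_propto_L_one_of_symmetricFamilies (fun D m ↦ qCoeffs (G₁ D) m)
    (fun D m ↦ qCoeffs (G₅ D) m) hκ₁ hκ₅
    (fun _ hD h1 ↦ (exists_qCoeffs_eq_mul_b_of_mem_chi2 (hmem₁ hD h1) (htwo₁ hD h1)).1)
    hsymm₁ hdiag₁
    (fun _ hD h5 ↦ (exists_qCoeffs_eq_mul_b_of_mem_chi2 (hmem₅ hD h5) (htwo₅ hD h5)).2)
    hsymm₅ hdiag₅

end Literature.NumberTheory.EllipticCurves.Tunnell1983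

end
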